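import Summits.BirchSwinnertonDyer.BirchSwinnertonDyer.Theorems.ThetaPartnerAtTwoSignedKatoUpToAtTwoPointsPackage
import Summits.BirchSwinnertonDyer.BirchSwinnertonDyer.Theorems.ThetaPartnerAtTwoSignedKatoUpToAtTwoOffTwoLocalPackageRat
import Summits.BirchSwinnertonDyer.BirchSwinnertonDyer.Theorems.ThetaPartnerAtTwoSignedKatoUpToAtTwoOffTwoOfPub
import Literature.NumberTheory.EllipticCurves.EisensteinNewformLevelRaisingDictionaryProofs
import Literature.NumberTheory.EllipticCurves.IwasawaAlgebraInvolution
import HarnessLib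

/-!
# Route `ThetaPartnerAtTwo` (TP2), crux K3 `SignedKatoDivisibilityUpToAtTwo` (item stmt-BirchSwinnertonDyer-20308),
# line `colemanrat` — (R2^ι) REDUCED TO ITS `𝐇¹`-SIDE (R2b): the transfer theorem

Lead `bsd-wall-tp2-p2x` g4 (cell `bsd-wall`). HONEST FRAMING: ONE THEOREM, an implication between two fully spelled statements
(no definition, no named fact, no instance, no `sorry`); closes no item; BSD is NOT proved by any of this.

The registered research stub (R2^ι) `Cruxes.SignedKatoDivisibilityUpToAtTwo.ColemanRat.stub_localRobustPackageTwoInv` asks per place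
`v ∋ 2`, pinned dual `D` and height-one `𝔭 ∌ 2` for the localised 2-robust Coleman/Poitou–Tate package. Its `P`-side is KERNEL
(`KummerPoint.exists_pointsPackage_two`, with HONDA⁺@2 = `Cruxes.SignedControlAtTwo.EulerChar.stub_plusHondaSystemTwo` and the points-model
`j₀` = `KummerPoint.exists_pointsModelJ_two`, both hypothesis-free theorems of the tree). This file proves that (R2^ι) FOLLOWS from the
strictly smaller `𝐇¹`-side statement (R2b) = «for some local lift `g` of the generator and some plus Honda system `d` at `v`
((L)(TR)(GEN)(GEN₀)): a pinned `I = 𝐇¹_Γ(T₂E)`, an ADDITIVE `col₀ : 𝐇¹ → Hom(E(ℚ_{2,∞}·ℚ_v), ℤ₂)` intertwining `Λ` with Sprung's action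
`lambdaSMul` (the `T₂E`-adic LOCAL TATE PAIRING along the tower, [Kato2004Asterisque, §17.13]), the raw GLOBAL RECIPROCITY «the pairing of
`2^m·x` with every Kummer witness of every `⁺`-Selmer class is `≡ 0`» (Poitou–Tate along `ℚ_∞`; the tree's Selmer classes are locally
trivial away from `2`, [Kobayashi2003, (7.17)–(7.21)]), a genuine 2-adic Euler-system class `s`, and the EXPLICIT RECIPROCITY LAW at `2` in
Coleman currency «`ℓ_𝔭(Λ/Col♭(col₀ s)) ≤ ℓ_𝔭(Λ/L♭)`» ([Kato2004Asterisque, Thm. 12.5, 16.6]; [Kobayashi2003, Thm. 6.3]; Otsuki 2009 at `p = 2`)».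
So the research residue of the line is EXACTLY (R2b); everything else of (R2^ι) is kernel.

## What is proved
* `SignedKatoOffTwo.localRobustPackageTwoInv_of_h1SideTwoInv` — (R2b) → (R2^ι), both statements verbatim (the conclusion is the registered
  stub's signature): `P, ι_P, j` from the points package; `col := q ∘ col₀` (`Λ`-linear by the intertwining clause); (KerIota) from
  injectivity; (Rec) from (Rec₀) through the value formula of `j₀` and `ι(2^m) = 2^m`; (LocCover) with exponent `m` from exponent `0`;
  (Z) at the unique ♭-Coleman value of `col₀ s`.

References: [Kobayashi2003] Thm. 6.2–6.3, (7.17)–(7.21), Thm. 7.3; [Sprung2012] Def. 5.9, 7.9; [Kato2004Asterisque] Thm. 12.5, §13, §17.13.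
-/

set_option autoImplicit false
-- the Theorems namespace of this sub repeats the summit name by design (D-0017 nested layout)
set_option linter.dupNamespace false

noncomputable section

open scoped Classical MatrixGroups ModularForm NumberField

open CongruenceSubgroup WeierstrassCurve Field IsDedekindDomain NumberField
  Literature.NumberTheory.GaloisRepresentations
  Literature.NumberTheory.EllipticCurves Literature.NumberTheory.EllipticCurves.ModularForms
  Literature.NumberTheory.EllipticCurves.Module Literature.NumberTheory.EllipticCurves.Rank1Residual
  Literature.NumberTheory.EllipticCurves.Kobayashi2003 Literature.NumberTheory.EllipticCurves.Kato2004
  Literature.NumberTheory.EllipticCurves.Kato2004.EulerSystemValues Literature.NumberTheory.EllipticCurves.GreenbergSelmer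
  Literature.NumberTheory.EllipticCurves.Sprung2012
  ZpExtension Summit.BirchSwinnertonDyer.Rank1Residual.Supersingular

namespace Summit.BirchSwinnertonDyer.BirchSwinnertonDyer.Theorems.SignedKatoOffTwo

/-- **(R2b) ⟹ (R2^ι): the `ι`-repaired localised 2-robust package follows from its `𝐇¹`-side.** Hypothesis (R2b): per `v ∋ 2`, habitat
data and height-one `𝔭 ∌ 2`, SOME local lift `g` of the generator and SOME plus Honda system `d` at `v` ((L)(TR)(GEN)(GEN₀)) carry a pinned
`I = 𝐇¹_Γ(T₂E)`, an additive `col₀ : 𝐇¹ → Hom(E(ℚ_{2,∞}·ℚ_v), ℤ₂)` with `col₀ (r • x) = lambdaSMul r (col₀ x)` (local Tate pairing along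
the tower), the raw global reciprocity with exponent `m` against Kummer witnesses of `⁺`-Selmer classes, a genuine 2-adic Euler-system
class `s`, and the explicit reciprocity law at `2` in ♭-Coleman currency at `𝔭`. Conclusion: the registered stub (R2^ι) verbatim —
`P := Hom ⧸ Ker Col♭`, `ι_P := Col♭`, `j := j₀ ∘ res_{A⁺}` (tree: `KummerPoint.exists_pointsPackage_two`, HONDA⁺@2, `exists_pointsModelJ_two`),
`col := q ∘ col₀`. [cite: Kobayashi2003, Thm. 6.2–6.3 (p. 11), (7.17)–(7.21), Thm. 7.3 (pp. 12–13)] [cite: Sprung2012, Def. 5.9 (p. 1495), Def. 7.9 (p. 1503)]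
[cite: Kato2004Asterisque, Thm. 12.5 (p. 222), §13.1 (p. 224), §17.13 (p. 279)] -/
theorem localRobustPackageTwoInv_of_h1SideTwoInv
    (h : ∀ (v : HeightOneSpectrum (𝓞 ℚ)), ((2 : ℕ) : 𝓞 ℚ) ∈ v.asIdeal →
      ∀ (W : WeierstrassCurve ℚ) [W.IsElliptic] [W.IsGloballyMinimal],
        ¬ W.HasCM → W.analyticRank = 0 → GoodSS W 2 → W.frobeniusTrace 2 = 0 →
        ∀ (κ : ZpExtension ℚ 2) (γ : Field.absoluteGaloisGroup ℚ) (hκ : κ.IsCyclotomic),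
          κ.IsTopGenerator γ → IsCyclotomicVariable 2 γ →
          ∀ [NeZero (W.conductorNorm ℤ)] (f : CuspForm (Gamma0 (W.conductorNorm ℤ)) 2),
            IsNewformOf W f → ∀ (ϖ : ℚ), (ϖ : ℝ) * W.realPeriodRat = plusPeriod f →
          ∀ (Lplus Lminus : IwasawaAlgebra 2), IsPollackPair f 2 Lplus Lminus →
          ∀ [ContinuousSMul ℤ_[2] (W.tateModule 2)] [Module.Free ℤ_[2] (W.tateModule 2)]
            [Module.Finite ℤ_[2] (W.tateModule 2)],
          ∀ 𝔭 : PrimeSpectrum (IwasawaAlgebra 2), 𝔭.asIdeal.height = 1 →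
            PowerSeries.C (2 : ℤ_[2]) ∉ 𝔭.asIdeal →
          ∃ (g : absoluteGaloisGroup (v.adicCompletion ℚ))
            (hg : κ.IsTopGenerator (resGalOfEmb (closureEmb (K := ℚ) (v.adicCompletion ℚ)) g))
            (d : ℕ → localPoints W (v.adicCompletion ℚ))
            (I : Kato2004.IwasawaH1Data W 2 κ γ)
            (col₀ : I.H →+ (localTowerPointsOfEmb κ (closureEmb (K := ℚ) (v.adicCompletion ℚ)) W →+ ℤ_[2]))
            (s : I.H) (m : ℕ),
            (∀ n, d n ∈ localLayerPointsOfEmb κ (closureEmb (K := ℚ) (v.adicCompletion ℚ)) W n) ∧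
            (∀ n, localTraceOfEmb κ (closureEmb (K := ℚ) (v.adicCompletion ℚ)) W (n + 1) (n + 2) (d (n + 2)) = -d n) ∧
            (∀ n : ℕ, 1 ≤ n → ∀ P ∈ localLayerPointsOfEmb κ (closureEmb (K := ℚ) (v.adicCompletion ℚ)) W n,
              ∃ B ∈ AddSubgroup.closure (Set.range fun σ : absoluteGaloisGroup (v.adicCompletion ℚ) ↦ σ • d n),
                ∃ P' ∈ localLayerPointsOfEmb κ (closureEmb (K := ℚ) (v.adicCompletion ℚ)) W (n - 1),
                ∃ R ∈ localLayerPointsOfEmb κ (closureEmb (K := ℚ) (v.adicCompletion ℚ)) W n, P = B + P' + 2 • R) ∧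
            (∀ P ∈ localLayerPointsOfEmb κ (closureEmb (K := ℚ) (v.adicCompletion ℚ)) W 0,
              ∃ a : ℤ, ∃ R ∈ localLayerPointsOfEmb κ (closureEmb (K := ℚ) (v.adicCompletion ℚ)) W 0, P = a • d 0 + 2 • R) ∧
            (∀ (r : IwasawaAlgebra 2) (x : I.H),
              col₀ (r • x) = lambdaSMul κ (closureEmb (K := ℚ) (v.adicCompletion ℚ)) W hg r (col₀ x)) ∧
            (∀ (x : I.H) (t : W.subgroupH1 2 κ.kerSubgroup), t ∈ signedSelmerInfty W κ 1 →
              ∀ (φ : contOneCocycles (discreteTopRep κ.kerSubgroup (W.geomPrimaryTorsion 2)))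
                (Q : localPoints W (v.adicCompletion ℚ)) (k : ℕ), oneCocycleClass _ φ = t →
              ∀ hQ : 2 ^ k • Q ∈ (⨆ n, signedLocalPoints κ (v.adicCompletion ℚ) W 1 n),
              (∀ τ : localSubgroupOfEmb κ.kerSubgroup (closureEmb (K := ℚ) (v.adicCompletion ℚ)),
                pointsMapOfEmb W (closureEmb (K := ℚ) (v.adicCompletion ℚ))
                    ((φ.1 (resGalSubgroupOfEmb κ.kerSubgroup _ τ) : W.geomPrimaryTorsion 2) : W.geomPoints) =
                  (τ : absoluteGaloisGroup (v.adicCompletion ℚ)) • Q - Q) →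
              (PadicInt.toZModPow k
                  (col₀ ((PowerSeries.C (2 : ℤ_[2]) : IwasawaAlgebra 2) ^ m • x)
                    ⟨2 ^ k • Q, KummerPoint.iSup_signedLocalPoints_le_localTowerPointsOfEmb W 2 κ 1 v hQ⟩)).val •
                ((((2 : ℚ) ^ k)⁻¹ : ℚ) : AddCircle (1 : ℚ)) = 0) ∧
            Kato2004.IsEulerSystemClassTwo W hκ I s ∧
            (∀ Ls Lf : IwasawaAlgebra 2,
              IsColemanPair κ (closureEmb (K := ℚ) (v.adicCompletion ℚ)) W 0 g d (col₀ s) Ls Lf →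
              lengthAt (IwasawaAlgebra 2) (IwasawaAlgebra 2 ⧸ Ideal.span {Lf}) 𝔭 ≤
                lengthAt (IwasawaAlgebra 2) (IwasawaAlgebra 2 ⧸ Ideal.span {kobayashiL 1 Lplus Lminus}) 𝔭)) :
    ∀ (v : HeightOneSpectrum (𝓞 ℚ)), ((2 : ℕ) : 𝓞 ℚ) ∈ v.asIdeal →
    ∀ (W : WeierstrassCurve ℚ) [W.IsElliptic] [W.IsGloballyMinimal],
      ¬ W.HasCM → W.analyticRank = 0 → GoodSS W 2 → W.frobeniusTrace 2 = 0 →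
      ∀ (κ : ZpExtension ℚ 2) (γ : Field.absoluteGaloisGroup ℚ) (hκ : κ.IsCyclotomic),
        κ.IsTopGenerator γ → IsCyclotomicVariable 2 γ →
        ∀ [NeZero (W.conductorNorm ℤ)] (f : CuspForm (Gamma0 (W.conductorNorm ℤ)) 2),
          IsNewformOf W f → ∀ (ϖ : ℚ), (ϖ : ℝ) * W.realPeriodRat = plusPeriod f →
        ∀ (Lplus Lminus : IwasawaAlgebra 2), IsPollackPair f 2 Lplus Lminus →
        ∀ (D : SignedSelmerDualData W κ γ 1) [ContinuousSMul ℤ_[2] (W.tateModule 2)]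
          [Module.Free ℤ_[2] (W.tateModule 2)] [Module.Finite ℤ_[2] (W.tateModule 2)],
          Module.IsTorsion (IwasawaAlgebra 2) D.X →
          ∀ 𝔭 : PrimeSpectrum (IwasawaAlgebra 2), 𝔭.asIdeal.height = 1 →
            PowerSeries.C (2 : ℤ_[2]) ∉ 𝔭.asIdeal →
          ∃ (I : Kato2004.IwasawaH1Data W 2 κ γ)
            (P : Type) (_ : AddCommGroup P) (_ : _root_.Module (IwasawaAlgebra 2) P)
            (ι : P →ₗ[IwasawaAlgebra 2] IwasawaAlgebra 2) (col : I.H →ₗ[IwasawaAlgebra 2] P)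
            (j : P →+ D.X) (s : I.H) (m : ℕ),
            (∀ (g : IwasawaAlgebra 2) (y : P), j (g • y) = IwasawaAlgebra.invol 2 g • j y) ∧
            (∀ y, ι y = 0 → (PowerSeries.C (2 : ℤ_[2]) : IwasawaAlgebra 2) ^ m • y = 0) ∧
            (∀ x, (PowerSeries.C (2 : ℤ_[2]) : IwasawaAlgebra 2) ^ m • j (col x) = 0) ∧
            (∀ x : D.X,
              (∀ t : signedSelmerInfty W κ 1,
                resOfLe (W.geomPrimaryTorsion 2) (inf_le_left : κ.kerSubgroup ⊓ decomp v ≤ κ.kerSubgroup)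
                  (t : W.subgroupH1 2 κ.kerSubgroup) = 0 → D.toDual x t = 0) →
              ∃ y : P, j y = (PowerSeries.C (2 : ℤ_[2]) : IwasawaAlgebra 2) ^ m • x) ∧
            Kato2004.IsEulerSystemClassTwo W hκ I s ∧
            lengthAt (IwasawaAlgebra 2) (IwasawaAlgebra 2 ⧸ Ideal.span {ι (col s)}) 𝔭 ≤
              lengthAt (IwasawaAlgebra 2) (IwasawaAlgebra 2 ⧸ Ideal.span {kobayashiL 1 Lplus Lminus}) 𝔭 := by
  intro v hv W _ _ hCM hr hss ha κ γ hκ hγ hcyc _ f hf ϖ hϖ Lplus Lminus hPo D _ _ _ _ 𝔭 h𝔭 hC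
  obtain ⟨g, hg, d, I, col₀, s, m, hd, htr, hgen, hgen0, hlin, hrec, hES, hZ⟩ :=
    h v hv W hCM hr hss ha κ γ hκ hγ hcyc f hf ϖ hϖ Lplus Lminus hPo 𝔭 h𝔭 hC
  have hv2 : (2 : 𝓞 ℚ) ∈ v.asIdeal := by exact_mod_cast hv
  obtain ⟨j₀, hj⟩ := KummerPoint.exists_pointsModelJ_two W κ 1 hss v hv2 D
  obtain ⟨P, _, _, ιP, q, j, hinj, -, hq, hpair, -, hjq, hsemi, hcov⟩ :=
    KummerPoint.exists_pointsPackage_two W hss hκ hγ v hv2 hg hd htr hgen hgen0 D j₀ hj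
  have hιC : ∀ n : ℕ, IwasawaAlgebra.invol 2 ((PowerSeries.C (2 : ℤ_[2]) : IwasawaAlgebra 2) ^ n) =
      (PowerSeries.C (2 : ℤ_[2]) : IwasawaAlgebra 2) ^ n := fun n ↦ by
    rw [map_pow, IwasawaAlgebra.invol_C]
  -- `col := q ∘ col₀`, `Λ`-linear by the intertwining clause
  let col : I.H →ₗ[IwasawaAlgebra 2] P :=
    { toFun := fun x ↦ q (col₀ x)
      map_add' := fun x y ↦ by rw [map_add, map_add]
      map_smul' := fun r x ↦ by rw [RingHom.id_apply, hlin, hq] }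
  refine ⟨I, P, inferInstance, inferInstance, ιP, col, j, s, m, hsemi, fun y hy ↦ ?_, fun x ↦ ?_, fun x hx ↦ ?_, hES, ?_⟩
  · -- (KerIota): `ι_P` is injective, so its kernel is (trivially) `2^m`-torsion
    rw [hinj (hy.trans (map_zero ιP).symm), smul_zero]
  · -- (Rec): `2^m · j (col x) = j₀ ((col₀ (2^m x))|_{A⁺}) = 0` by the value formula and (Rec₀)
    change (PowerSeries.C (2 : ℤ_[2]) : IwasawaAlgebra 2) ^ m • j (q (col₀ x)) = 0
    rw [← hιC m, ← hsemi, ← hq, ← hlin, hjq]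
    apply D.bijective.1
    rw [map_zero]
    ext ⟨t, ht⟩
    rw [AddMonoidHom.zero_apply]
    obtain ⟨φ, Q, k, hφ, hQ, hτ⟩ := (mem_localKummerOverOfEmb_iff _ t).1
      (SignedEC.signedSelmerInfty_le_localKummerOverOfEmb_iSup_signedLocalPoints W κ 1 v hv ht)
    rw [hj _ t ht φ Q k hφ hQ hτ]
    exact hrec x t ht φ Q k hφ hQ hτ
  · -- (LocCover) with exponent `m` from exponent `0`
    obtain ⟨y, hy⟩ := hcov x hx
    exact ⟨(PowerSeries.C (2 : ℤ_[2]) : IwasawaAlgebra 2) ^ m • y, by rw [hsemi, hιC, hy]⟩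
  · -- (Z) at the unique ♭-Coleman value of `col₀ s`
    obtain ⟨Ls, hLs⟩ := hpair (col₀ s)
    exact hZ Ls _ hLs

end Summit.BirchSwinnertonDyer.BirchSwinnertonDyer.Theorems.SignedKatoOffTwo

end
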